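/-
Copyright: statement-level skeleton of a published paper (lit-balaban cell, Phase-2 proof seat p13, gen 9). No proof
claims beyond what the kernel checks below.
-/
import Literature.MathematicalPhysics.QuantumFieldTheory.BalabanImbrieJaffe1984to88.BIJ88WSplit290Inputs

/-!
# `BalabanImbrieJaffe1984to88.BIJ88WSplit290Small` — T. Bałaban, J. Imbrie, A. Jaffe, *Effective action and cluster
properties of the abelian Higgs model*, Commun. Math. Phys. **114** (1988) 257–315 [BalabanImbrieJaffe1988]: Sect. 5.7,
(5.7.7) p. 290 — THE SMALL-COUPLING REGIME.  The printed sizes *"|F_{1,j,b}(X)| ≦ e_j^{n̄+1−α}e^{−cr(e_k)|X|⁻}"*, *"Both terms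
involve small, bounded kernels (of order e_j^{1−α} for V^{(n̄)}, of order e_j^{n̄+1−α}e^{−cr(e_k)|X|⁻} for V(X))"* and *"|W^{(j)}(X;
x₁, x₂)| ≦ e_j^{n̄+1−α}e^{−cr(e_k)|X|⁻}"* were landed (files 1a `BIJ88F1Localized290`, 2b `BIJ88Expansion577Bounds`, 3
`BIJ88WSplit290`) with every constant explicit and the PRINTED SHAPES under DISPLAYED constants inequalities (generic-constant
reading).  Here those displayed inequalities are DISCHARGED in the regime the print works in — `e_j → 0⁺` with the other data
(`ζ`, `p = p(e_k)`-type field bounds, kernel constants, the weight `ρ`, the number of sites of `□(x₁,x₂)`) held fixed: for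
every `α > 0` they hold for all sufficiently small `e_j`, so the three printed shapes hold for small `e_j` with NO constants
hypothesis (file 7 of seat p13 gen 9).

statement-level skeleton of published theorems with citation tags; proofs where landed; nothing here is a claim about the Yang–Mills mass gap

PDF held: `paper:balaban1988-cmp114-bij-abelian-higgs-effective-action` (journal page = PDF page + 256); p. 290 [PDF 34]
read as IMAGE (CCITT render; copy `HOME/lit-balaban-p13/pages/original-p034-x2.png`).

CITATION HEADER (lean-in-tree rule).  Part of the lit-balaban TYPED SKELETON (HOME `run/shared/lean/pub/lit-balaban/`):
WHAT IS REPRODUCED = row **C2.Eq5.7.7-5.7.9** of `HOME/lit-balaban-r16/ROWS-C2-part2.md`, member (5.7.7): the order-in-`e_j`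
claims of p. 290 as `e_j → 0⁺` statements.  Unit `lit-balaban-p13` (gen 9), owner r16, referee ref-5.  Built BY NAME on
1a (`LocDatum.norm_F1loc_le_printed`), 2b (`norm_vertexAct_le_printed`), 3 (`Hyps.norm_wExp_act_le_printed`), 4 (`glF1`,
`glF1_rooted`, `lowNormW_glF1_le`, `actNorm_glF1_le`) and 6 (`hyps_of_F1`); nothing restated.

## What is kernel-checked here

* §1 small-coupling arithmetic (PRIVATE helpers, [folklore]): `eventually_const_mul_rpow_le_one`, `eventually_const_mul_pow_le`,
  `eventually_pos_le`, `exists_threshold` (an eventual statement at `0⁺` as an explicit threshold `ε₀`),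
  `const_mul_pow_le_rpow_sub` (`Kε^{n̄+1} ≤ ε^{n̄+1−α}` once `Kε^α ≤ 1`), `bracket_le`/`bracket_le'`/`bracket_nonneg` (the
  bracket `(e_j/ρ)^{n̄+1}L² + 2Lδ + δ²` is `O(e_j^{n̄+1})` when `δ = O(e_j^{n̄+1})`), `delta_nonneg`/`delta_le`/`D1_nonneg`
  (`δ(e_j) = 2δ₀(e_j)`, twice the constant of 1a's `norm_F1loc_le`, is `≤ D₁e_j^{n̄+1}` on `[0,1]`).
* §2 THE REGIMES: **`eventually_hfield`** (1a's field-regime inequality `ζ^{n̄}(p+1)^{n̄+1}e^{e_jζ(p+1)}/(n̄+1)! ≤ e_j^{−α}`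
  for `e_j → 0⁺`), **`eventually_regime_vertex`** (2b's constants inequality for `e_j → 0⁺`), **`eventually_regime`** (3's
  constants inequality `γg(qℓ+a)/(1−θ)² ≤ e_j^{n̄+1−α′}` together with `|e_j| ≤ ρ` and the convergence condition
  `θ = g(ℓ+a) < 1`, for `e_j → 0⁺`, given `gℓ < 1`), `eventually_gl_lt_one`/`exists_gl_lt_one` (a weight `ρ > 0` with
  `gℓ(ρ) < 1` exists, `ℓ(ρ) = N·C·L(ρ)²`, `L(ρ) = ρRe^{ρζR}`).
* §3 THE PRINTED SHAPES WITHOUT CONSTANTS HYPOTHESES, for small `e_j`: **`norm_F1loc_le_printed_small`**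
  (`|F_{1,j,b}(X)| ≤ e_j^{n̄+1−α}e^{−cr(e_k)|X|⁻}`), **`norm_vertexAct_le_printed_small`** (`|V_j(X)| ≤ e_j^{n̄+1−α}e^{−κ′|X|⁻}`
  for vertices of `F_{1,j}`-type factors), **`norm_wAct_le_printed_small`** (`|W^{(j)}(X;x₁,x₂)| ≤ e_j^{n̄+1−α}e^{−κ′|X|⁻}`
  for the propagator series with such vertices) and its threshold form `norm_wAct_le_printed_threshold`.

HONEST SCOPE.  Model level, as files 1a–6: the regime is `e_j → 0⁺` with ALL OTHER DATA FIXED — in particular the number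
of sites `|T|` of `□(x₁,x₂)`, the field bound `p` (the print's `p(e_k)`, absorbed there by `e^{−cr(e_k)}`; cf. r16's
`eventually_hlarge576`) and the kernel constants; the print's uniformity in `k` (constants independent of the step) is NOT
derived here.  Theorems only; no definitions, no `Prop` facts; axioms standard.
-/

noncomputable section

open scoped BigOperators Topology
open Finset Filter

namespace Literature.MathematicalPhysics.QuantumFieldTheory.BalabanImbrieJaffe1984to88.BIJ88WSplit290Small

open BIJ88TraceTerms579 (cubePolymers)
open BIJ88Sect5StatementsPart2 (PolymerSys Ineq576)
open BIJ88F1Localized290 (wloc LocDatum)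
open BIJ88Expansion577 BIJ88Expansion577.GLExp BIJ88Expansion577Bounds BIJ88WSplit290 BIJ88F1Expansion577
  BIJ88WSplit290Inputs
open Literature.Probability.LatticeModels (IsRConnected)

/-! ## §1 Small-coupling arithmetic (`ε = e_j → 0⁺`, all other data fixed) -/

section Analysis

/-- `c·ε^α ≤ 1` as `ε → 0⁺` (`α > 0`). [folklore] -/
private theorem eventually_const_mul_rpow_le_one (c : ℝ) {α : ℝ} (hα : 0 < α) :
    ∀ᶠ ε in 𝓝[>] (0 : ℝ), c * ε ^ α ≤ 1 := by
  have h : Tendsto (fun ε : ℝ => c * ε ^ α) (𝓝 0) (𝓝 (c * (0 : ℝ) ^ α)) :=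
    (Real.continuousAt_rpow_const 0 α (Or.inr hα.le)).tendsto.const_mul c
  rw [Real.zero_rpow hα.ne', mul_zero] at h
  exact ((h.mono_left nhdsWithin_le_nhds).eventually (eventually_lt_nhds zero_lt_one)).mono fun _ h => h.le

/-- `c·εⁿ ≤ m` as `ε → 0⁺` (`m > 0`, `n ≥ 1`). [folklore] -/
private theorem eventually_const_mul_pow_le (c : ℝ) {m : ℝ} (hm : 0 < m) {n : ℕ} (hn : n ≠ 0) :
    ∀ᶠ ε in 𝓝[>] (0 : ℝ), c * ε ^ n ≤ m := by
  have h : Tendsto (fun ε : ℝ => c * ε ^ n) (𝓝 0) (𝓝 (c * (0 : ℝ) ^ n)) :=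
    (continuous_const.mul (continuous_pow n)).tendsto 0
  rw [zero_pow hn, mul_zero] at h
  exact ((h.mono_left nhdsWithin_le_nhds).eventually (eventually_lt_nhds hm)).mono fun _ h => h.le

/-- `0 < ε ≤ r` as `ε → 0⁺` (`r > 0`). [folklore] -/
private theorem eventually_pos_le {r : ℝ} (hr : 0 < r) : ∀ᶠ ε in 𝓝[>] (0 : ℝ), 0 < ε ∧ ε ≤ r :=
  (eventually_mem_nhdsWithin.and ((eventually_lt_nhds hr).filter_mono nhdsWithin_le_nhds)).mono
    fun _ h => ⟨h.1, h.2.le⟩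

/-- an eventual statement at `0⁺` as an explicit threshold: `∃ ε₀ > 0, ∀ ε ∈ (0, ε₀), P ε`. [folklore] -/
private theorem exists_threshold {P : ℝ → Prop} (h : ∀ᶠ ε in 𝓝[>] (0 : ℝ), P ε) :
    ∃ ε₀, 0 < ε₀ ∧ ∀ ε, 0 < ε → ε < ε₀ → P ε := by
  rw [eventually_nhdsWithin_iff, Metric.eventually_nhds_iff] at h
  obtain ⟨ε₀, hε₀, h⟩ := h
  refine ⟨ε₀, hε₀, fun ε hε hεε => h ?_ hε⟩
  rwa [Real.dist_eq, sub_zero, abs_of_pos hε]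

/-- `Kε^{n+1} ≤ ε^{n+1−α}` once `Kε^α ≤ 1` (`ε > 0`). [folklore] -/
private theorem const_mul_pow_le_rpow_sub {K ε α : ℝ} (n : ℕ) (hε : 0 < ε) (h : K * ε ^ α ≤ 1) :
    K * ε ^ (n + 1) ≤ ε ^ ((n : ℝ) + 1 - α) := by
  have hsplit : ε ^ (n + 1) = ε ^ α * ε ^ ((n : ℝ) + 1 - α) := by
    rw [← Real.rpow_add hε, show α + ((n : ℝ) + 1 - α) = ((n + 1 : ℕ) : ℝ) by push_cast; ring,
      Real.rpow_natCast]
  rw [hsplit, ← mul_assoc]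
  exact (mul_le_mul_of_nonneg_right h (Real.rpow_nonneg hε.le _)).trans_eq (one_mul _)

/-- the bracket of the `a`-type sizes is `O(ε^{n̄+1})`: `0 ≤ δ ≤ D₁ε^{n̄+1}`, `0 < ε ≤ 1` ⇒
`(|ε|/ρ)^{n̄+1}L·L + Lδ + δL + δδ ≤ (L·L/ρ^{n̄+1} + 2LD₁ + D₁D₁)ε^{n̄+1}`. [folklore] -/
private theorem bracket_le {nbar : ℕ} {ρ L D₁ δ ε : ℝ} (hL : 0 ≤ L) (hD : 0 ≤ D₁) (hδ0 : 0 ≤ δ)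
    (hδ : δ ≤ D₁ * ε ^ (nbar + 1)) (hε : 0 < ε) (hε1 : ε ≤ 1) :
    (|ε| / ρ) ^ (nbar + 1) * (L * L) + L * δ + δ * L + δ * δ ≤
      (L * L / ρ ^ (nbar + 1) + 2 * L * D₁ + D₁ * D₁) * ε ^ (nbar + 1) := by
  have hx0 : 0 ≤ ε ^ (nbar + 1) := pow_nonneg hε.le _
  have hx1 : ε ^ (nbar + 1) ≤ 1 := pow_le_one₀ hε.le hε1
  have h1 : (|ε| / ρ) ^ (nbar + 1) * (L * L) = L * L / ρ ^ (nbar + 1) * ε ^ (nbar + 1) := by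
    rw [abs_of_pos hε, div_pow]; ring
  have h2 : L * δ ≤ L * D₁ * ε ^ (nbar + 1) := by rw [mul_assoc]; exact mul_le_mul_of_nonneg_left hδ hL
  have h3 : δ * δ ≤ D₁ * D₁ * ε ^ (nbar + 1) :=
    calc δ * δ ≤ D₁ * ε ^ (nbar + 1) * (D₁ * ε ^ (nbar + 1)) := mul_le_mul hδ hδ hδ0 (mul_nonneg hD hx0)
      _ = D₁ * D₁ * (ε ^ (nbar + 1) * ε ^ (nbar + 1)) := by ring
      _ ≤ D₁ * D₁ * ε ^ (nbar + 1) :=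
          mul_le_mul_of_nonneg_left (mul_le_of_le_one_left hx0 hx1) (mul_nonneg hD hD)
  rw [h1, mul_comm δ L]
  linarith

/-- the same bracket in the shape of 2b's `norm_vertexAct_le_printed`. [folklore] -/
private theorem bracket_le' {nbar : ℕ} {ρ L D₁ δ ε : ℝ} (hL : 0 ≤ L) (hD : 0 ≤ D₁) (hδ0 : 0 ≤ δ)
    (hδ : δ ≤ D₁ * ε ^ (nbar + 1)) (hε : 0 < ε) (hε1 : ε ≤ 1) :
    (ε / ρ) ^ (nbar + 1) * L ^ 2 + 2 * L * δ + δ ^ 2 ≤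
      (L * L / ρ ^ (nbar + 1) + 2 * L * D₁ + D₁ * D₁) * ε ^ (nbar + 1) := by
  have h := bracket_le (ρ := ρ) hL hD hδ0 hδ hε hε1
  rw [abs_of_pos hε] at h
  calc (ε / ρ) ^ (nbar + 1) * L ^ 2 + 2 * L * δ + δ ^ 2
      = (ε / ρ) ^ (nbar + 1) * (L * L) + L * δ + δ * L + δ * δ := by ring
    _ ≤ _ := h

/-- nonnegativity of the bracket. [folklore] -/
private theorem bracket_nonneg {nbar : ℕ} {ρ L δ ε : ℝ} (hρ : 0 ≤ ρ) (hL : 0 ≤ L) (hδ0 : 0 ≤ δ) :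
    0 ≤ (|ε| / ρ) ^ (nbar + 1) * (L * L) + L * δ + δ * L + δ * δ :=
  add_nonneg (add_nonneg (add_nonneg (mul_nonneg (pow_nonneg (div_nonneg (abs_nonneg _) hρ) _)
    (mul_nonneg hL hL)) (mul_nonneg hL hδ0)) (mul_nonneg hδ0 hL)) (mul_nonneg hδ0 hδ0)

/-- `δ(ε) = 2δ₀(ε)` — twice the constant of 1a's `norm_F1loc_le` (4's `actNorm_glF1_le`) — is nonnegative. [folklore] -/
private theorem delta_nonneg {nbar : ℕ} {ζ p M ε : ℝ} (hζ : 0 ≤ ζ) (hpM : 0 ≤ p + M) (hε : 0 ≤ ε) :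
    0 ≤ 2 * (ζ ^ nbar * (ε * (p + M)) ^ (nbar + 1) / ((nbar + 1).factorial : ℝ) * Real.exp (ε * ζ * (p + M))) :=
  mul_nonneg zero_le_two (mul_nonneg (div_nonneg (mul_nonneg (pow_nonneg hζ _)
    (pow_nonneg (mul_nonneg hε hpM) _)) (Nat.cast_nonneg _)) (Real.exp_pos _).le)

/-- `δ(ε) ≤ D₁ε^{n̄+1}` on `[0,1]`, `D₁ = 2ζ^{n̄}(p+M)^{n̄+1}e^{ζ(p+M)}/(n̄+1)!` — *"of order e_j^{n̄+1−α}"*. [folklore] -/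
private theorem delta_le {nbar : ℕ} {ζ p M ε : ℝ} (hζ : 0 ≤ ζ) (hpM : 0 ≤ p + M) (hε : 0 ≤ ε) (hε1 : ε ≤ 1) :
    2 * (ζ ^ nbar * (ε * (p + M)) ^ (nbar + 1) / ((nbar + 1).factorial : ℝ) * Real.exp (ε * ζ * (p + M))) ≤
      2 * (ζ ^ nbar * (p + M) ^ (nbar + 1) / ((nbar + 1).factorial : ℝ) * Real.exp (ζ * (p + M))) *
        ε ^ (nbar + 1) := by
  have hexp : Real.exp (ε * ζ * (p + M)) ≤ Real.exp (ζ * (p + M)) := by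
    rw [Real.exp_le_exp, mul_assoc]
    exact mul_le_of_le_one_left (mul_nonneg hζ hpM) hε1
  have hK : 0 ≤ ζ ^ nbar * (p + M) ^ (nbar + 1) / ((nbar + 1).factorial : ℝ) :=
    div_nonneg (mul_nonneg (pow_nonneg hζ _) (pow_nonneg hpM _)) (Nat.cast_nonneg _)
  calc 2 * (ζ ^ nbar * (ε * (p + M)) ^ (nbar + 1) / ((nbar + 1).factorial : ℝ) * Real.exp (ε * ζ * (p + M)))
      = 2 * (ζ ^ nbar * (p + M) ^ (nbar + 1) / ((nbar + 1).factorial : ℝ)) * ε ^ (nbar + 1) *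
          Real.exp (ε * ζ * (p + M)) := by rw [mul_pow]; ring
    _ ≤ 2 * (ζ ^ nbar * (p + M) ^ (nbar + 1) / ((nbar + 1).factorial : ℝ)) * ε ^ (nbar + 1) *
          Real.exp (ζ * (p + M)) :=
        mul_le_mul_of_nonneg_left hexp (mul_nonneg (mul_nonneg zero_le_two hK) (pow_nonneg hε _))
    _ = _ := by ring

/-- the constant `D₁` is nonnegative. [folklore] -/
private theorem D1_nonneg {nbar : ℕ} {ζ p M : ℝ} (hζ : 0 ≤ ζ) (hpM : 0 ≤ p + M) :
    0 ≤ 2 * (ζ ^ nbar * (p + M) ^ (nbar + 1) / ((nbar + 1).factorial : ℝ) * Real.exp (ζ * (p + M))) :=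
  mul_nonneg zero_le_two (mul_nonneg (div_nonneg (mul_nonneg (pow_nonneg hζ _) (pow_nonneg hpM _))
    (Nat.cast_nonneg _)) (Real.exp_pos _).le)

end Analysis

/-! ## §2 The three displayed constants inequalities hold for `e_j → 0⁺` -/

section Regimes

/-- **THE FIELD REGIME OF THE FIRST DISPLAY** (1a's `norm_F1loc_le_printed`): `ζ^{n̄}(p+1)^{n̄+1}e^{e_jζ(p+1)}/(n̄+1)! ≤
e_j^{−α}` for `e_j → 0⁺`, every `α > 0` — the print's absorption of the powers of `p(e_k)` into `e_j^{−α}`.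
[cite: BalabanImbrieJaffe1988, (5.7.7) p.290] -/
theorem eventually_hfield (nbar : ℕ) {α ζ p : ℝ} (hα : 0 < α) (hζ : 0 ≤ ζ) (hp : 0 ≤ p + 1) :
    ∀ᶠ ej in 𝓝[>] (0 : ℝ),
      ζ ^ nbar * (p + 1) ^ (nbar + 1) * Real.exp (ej * ζ * (p + 1)) / ((nbar + 1).factorial : ℝ) ≤ ej ^ (-α) := by
  set F := ζ ^ nbar * (p + 1) ^ (nbar + 1) * Real.exp (ζ * (p + 1)) / ((nbar + 1).factorial : ℝ) with hF
  filter_upwards [eventually_pos_le one_pos, eventually_const_mul_rpow_le_one F hα] with ej h1 h3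
  obtain ⟨hej, hej1⟩ := h1
  have hexp : Real.exp (ej * ζ * (p + 1)) ≤ Real.exp (ζ * (p + 1)) := by
    rw [Real.exp_le_exp, mul_assoc]
    exact mul_le_of_le_one_left (mul_nonneg hζ hp) hej1
  calc ζ ^ nbar * (p + 1) ^ (nbar + 1) * Real.exp (ej * ζ * (p + 1)) / ((nbar + 1).factorial : ℝ)
      ≤ F := by
        rw [hF]
        exact div_le_div_of_nonneg_right (mul_le_mul_of_nonneg_left hexp
          (mul_nonneg (pow_nonneg hζ _) (pow_nonneg hp _))) (Nat.cast_nonneg _)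
    _ ≤ 1 / ej ^ α := by rw [le_div_iff₀ (Real.rpow_pos_of_pos hej α)]; exact h3
    _ = ej ^ (-α) := by rw [Real.rpow_neg hej.le, one_div]

/-- **THE REGIME OF THE `V_j(X)` SIZE CLAUSE** (2b's `norm_vertexAct_le_printed`): with uniform factor sizes `lowNormW ρ ≤ L`
(fixed) and `actNorm ≤ δ(e_j)`, `0 ≤ δ(e_j) ≤ D₁e_j^{n̄+1}` on `(0,1]` (*"of order e_j^{n̄+1−α}"*, 1a), and coefficients
`Σ_k‖c_k‖ ≤ C`: `C((e_j/ρ)^{n̄+1}L² + 2Lδ(e_j) + δ(e_j)²) ≤ e_j^{n̄+1−α′}` for `e_j → 0⁺`, every `α′ > 0`.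
[cite: BalabanImbrieJaffe1988, (5.7.7) p.290] -/
theorem eventually_regime_vertex {nbar : ℕ} {α' ρ C L D₁ : ℝ} {δ : ℝ → ℝ} (hα : 0 < α') (hρ : 0 < ρ)
    (hC : 0 ≤ C) (hL : 0 ≤ L) (hD : 0 ≤ D₁)
    (hδ0 : ∀ ε, 0 < ε → 0 ≤ δ ε) (hδ : ∀ ε, 0 < ε → ε ≤ 1 → δ ε ≤ D₁ * ε ^ (nbar + 1)) :
    ∀ᶠ ε in 𝓝[>] (0 : ℝ), 0 < ε ∧ ε ≤ ρ ∧
      C * ((ε / ρ) ^ (nbar + 1) * L ^ 2 + 2 * L * δ ε + δ ε ^ 2) ≤ ε ^ ((nbar : ℝ) + 1 - α') := by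
  set A := L * L / ρ ^ (nbar + 1) + 2 * L * D₁ + D₁ * D₁ with hA
  filter_upwards [eventually_pos_le (lt_min hρ one_pos), eventually_const_mul_rpow_le_one (C * A) hα]
    with ε h1 h3
  obtain ⟨hε, hεr⟩ := h1
  have hε1 : ε ≤ 1 := hεr.trans (min_le_right _ _)
  refine ⟨hε, hεr.trans (min_le_left _ _), ?_⟩
  calc C * ((ε / ρ) ^ (nbar + 1) * L ^ 2 + 2 * L * δ ε + δ ε ^ 2)
      ≤ C * (A * ε ^ (nbar + 1)) :=
        mul_le_mul_of_nonneg_left (bracket_le' hL hD (hδ0 ε hε) (hδ ε hε hε1) hε hε1) hC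
    _ = C * A * ε ^ (nbar + 1) := by ring
    _ ≤ ε ^ ((nbar : ℝ) + 1 - α') := const_mul_pow_le_rpow_sub nbar hε h3

/-- **THE REGIME OF THE `W^{(j)}(X)` KERNEL BOUND** (3's `Hyps.hθ` and `norm_wExp_act_le_printed`): with `ℓ = N·C·L²`
(`N` = number of sites of `□(x₁,x₂)`), `a(e_j) = N·C·((|e_j|/ρ)^{n̄+1}L² + Lδ(e_j) + δ(e_j)L + δ(e_j)²)`, `0 ≤ δ(e_j) ≤ D₁e_j^{n̄+1}`
on `(0,1]`, and `gℓ < 1`: for `e_j → 0⁺`, `|e_j| ≤ ρ`, `θ = g(ℓ + a) < 1` (*"the operator after the identity is bounded by a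
very small number"*) and `γg(qℓ + a)/(1−θ)² ≤ e_j^{n̄+1−α′}` (`q = (|e_j|/ρ)^{n̄+1}`), every `α′ > 0`.
[cite: BalabanImbrieJaffe1988, (5.7.7) p.290] -/
theorem eventually_regime {nbar : ℕ} {α' ρ γ g N C L D₁ : ℝ} {δ : ℝ → ℝ} (hα : 0 < α') (hρ : 0 < ρ)
    (hγ : 0 ≤ γ) (hg : 0 ≤ g) (hN : 0 ≤ N) (hC : 0 ≤ C) (hL : 0 ≤ L) (hD : 0 ≤ D₁)
    (hδ0 : ∀ ε, 0 < ε → 0 ≤ δ ε) (hδ : ∀ ε, 0 < ε → ε ≤ 1 → δ ε ≤ D₁ * ε ^ (nbar + 1))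
    (hgℓ : g * (N * (C * (L * L))) < 1) :
    ∀ᶠ ε in 𝓝[>] (0 : ℝ), 0 < ε ∧ |ε| ≤ ρ ∧
      g * (N * (C * (L * L)) +
          N * (C * ((|ε| / ρ) ^ (nbar + 1) * (L * L) + L * δ ε + δ ε * L + δ ε * δ ε))) < 1 ∧
      γ * (g * ((|ε| / ρ) ^ (nbar + 1) * (N * (C * (L * L))) +
            N * (C * ((|ε| / ρ) ^ (nbar + 1) * (L * L) + L * δ ε + δ ε * L + δ ε * δ ε)))) /
          (1 - g * (N * (C * (L * L)) +
            N * (C * ((|ε| / ρ) ^ (nbar + 1) * (L * L) + L * δ ε + δ ε * L + δ ε * δ ε)))) ^ 2 ≤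
        ε ^ ((nbar : ℝ) + 1 - α') := by
  set ℓ := N * (C * (L * L)) with hℓ
  set A := L * L / ρ ^ (nbar + 1) + 2 * L * D₁ + D₁ * D₁ with hA
  have hm : 0 < (1 - g * ℓ) / 2 := by linarith
  have hℓ0 : 0 ≤ ℓ := mul_nonneg hN (mul_nonneg hC (mul_nonneg hL hL))
  filter_upwards [eventually_pos_le (lt_min hρ one_pos),
    eventually_const_mul_pow_le (g * (N * (C * A))) hm (Nat.succ_ne_zero nbar),
    eventually_const_mul_rpow_le_one
      (γ * (g * (ℓ / ρ ^ (nbar + 1) + N * (C * A))) / ((1 - g * ℓ) / 2) ^ 2) hα] with ε h1 h2 h3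
  obtain ⟨hε, hεr⟩ := h1
  have hε1 : ε ≤ 1 := hεr.trans (min_le_right _ _)
  have hδε := hδ0 ε hε
  set Br := (|ε| / ρ) ^ (nbar + 1) * (L * L) + L * δ ε + δ ε * L + δ ε * δ ε with hBr
  have hBr0 : 0 ≤ Br := bracket_nonneg hρ.le hL hδε
  have hBrA : Br ≤ A * ε ^ (nbar + 1) := bracket_le hL hD hδε (hδ ε hε hε1) hε hε1
  have ha : g * (N * (C * Br)) ≤ (1 - g * ℓ) / 2 :=
    calc g * (N * (C * Br)) ≤ g * (N * (C * (A * ε ^ (nbar + 1)))) := by gcongr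
      _ = g * (N * (C * A)) * ε ^ (nbar + 1) := by ring
      _ ≤ (1 - g * ℓ) / 2 := h2
  have hθ : g * (ℓ + N * (C * Br)) < 1 := by rw [mul_add]; linarith
  have h1θ : (1 - g * ℓ) / 2 ≤ 1 - g * (ℓ + N * (C * Br)) := by rw [mul_add]; linarith
  refine ⟨hε, by rw [abs_of_pos hε]; exact hεr.trans (min_le_left _ _), hθ, ?_⟩
  have hq : (|ε| / ρ) ^ (nbar + 1) * ℓ = ℓ / ρ ^ (nbar + 1) * ε ^ (nbar + 1) := by
    rw [abs_of_pos hε, div_pow]; ring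
  have hnum : γ * (g * ((|ε| / ρ) ^ (nbar + 1) * ℓ + N * (C * Br))) ≤
      γ * (g * (ℓ / ρ ^ (nbar + 1) + N * (C * A))) * ε ^ (nbar + 1) :=
    calc γ * (g * ((|ε| / ρ) ^ (nbar + 1) * ℓ + N * (C * Br)))
        ≤ γ * (g * ((|ε| / ρ) ^ (nbar + 1) * ℓ + N * (C * (A * ε ^ (nbar + 1))))) := by gcongr
      _ = γ * (g * (ℓ / ρ ^ (nbar + 1) + N * (C * A))) * ε ^ (nbar + 1) := by rw [hq]; ring
  have hnum0 : 0 ≤ γ * (g * ((|ε| / ρ) ^ (nbar + 1) * ℓ + N * (C * Br))) :=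
    mul_nonneg hγ (mul_nonneg hg (add_nonneg
      (mul_nonneg (pow_nonneg (div_nonneg (abs_nonneg _) hρ.le) _) hℓ0) (mul_nonneg hN (mul_nonneg hC hBr0))))
  have hsq : ((1 - g * ℓ) / 2) ^ 2 ≤ (1 - g * (ℓ + N * (C * Br))) ^ 2 := pow_le_pow_left₀ hm.le h1θ 2
  calc γ * (g * ((|ε| / ρ) ^ (nbar + 1) * ℓ + N * (C * Br))) / (1 - g * (ℓ + N * (C * Br))) ^ 2
      ≤ γ * (g * ((|ε| / ρ) ^ (nbar + 1) * ℓ + N * (C * Br))) / ((1 - g * ℓ) / 2) ^ 2 :=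
        div_le_div_of_nonneg_left hnum0 (pow_pos hm 2) hsq
    _ ≤ γ * (g * (ℓ / ρ ^ (nbar + 1) + N * (C * A))) * ε ^ (nbar + 1) / ((1 - g * ℓ) / 2) ^ 2 :=
        div_le_div_of_nonneg_right hnum (pow_pos hm 2).le
    _ = γ * (g * (ℓ / ρ ^ (nbar + 1) + N * (C * A))) / ((1 - g * ℓ) / 2) ^ 2 * ε ^ (nbar + 1) := by ring
    _ ≤ ε ^ ((nbar : ℝ) + 1 - α') := const_mul_pow_le_rpow_sub nbar hε h3

/-- **a weight `ρ > 0` with `gℓ(ρ) < 1` exists**: `g·N·C·L(ρ)² < 1` for `ρ → 0⁺`, `L(ρ) = ρRe^{ρζR}` (4's `lowNormW_glF1_le`: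
the order-`≤ n̄` part of an `F_{1,j}` expansion has NO order-0 term — *"Each term in V_j has at least one factor e_j"*).
[cite: BalabanImbrieJaffe1988, (5.7.7) p.290] -/
theorem eventually_gl_lt_one (g N C R ζ : ℝ) :
    ∀ᶠ ρ in 𝓝[>] (0 : ℝ), 0 < ρ ∧
      g * (N * (C * (ρ * R * Real.exp (ρ * ζ * R) * (ρ * R * Real.exp (ρ * ζ * R))))) < 1 := by
  have hc : Continuous fun ρ : ℝ =>
      g * (N * (C * (ρ * R * Real.exp (ρ * ζ * R) * (ρ * R * Real.exp (ρ * ζ * R))))) := by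
    fun_prop
  have h := hc.tendsto 0
  simp only [zero_mul, mul_zero] at h
  exact eventually_mem_nhdsWithin.and ((h.mono_left nhdsWithin_le_nhds).eventually (eventually_lt_nhds one_pos))

/-- threshold form: such a weight `ρ` exists. [cite: BalabanImbrieJaffe1988, (5.7.7) p.290] -/
theorem exists_gl_lt_one (g N C R ζ : ℝ) :
    ∃ ρ, 0 < ρ ∧ g * (N * (C * (ρ * R * Real.exp (ρ * ζ * R) * (ρ * R * Real.exp (ρ * ζ * R))))) < 1 :=
  (eventually_gl_lt_one g N C R ζ).exists

end Regimes

/-! ## §3 The printed shapes without constants hypotheses, for small `e_j` -/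

section Printed

variable {ι : Type} [Fintype ι] [DecidableEq ι] {T : Type*} [Fintype T] {K : Type*} [Fintype K]
  {β : Type*} [Fintype β] (nbar : ℕ) (c₀ : ι)

omit [Fintype ι] [DecidableEq ι] in
/-- **THE FIRST DISPLAY AS PRINTED, SMALL FIELD**: for `e_j → 0⁺` (every `α > 0`; `ζ > 0`, `p ≥ 0`, `c·r(e_k) ≥ 0` fixed),
for every datum with `|a_loc| ≤ p`, (5.7.6) for all `m ≥ 1` and the empty collection on one cube:
`|F_{1,j,b}(X)| ≤ e_j^{n̄+1−α}e^{−cr(e_k)|X|⁻}` — 1a's `norm_F1loc_le_printed` with its field-regime hypothesis DISCHARGED by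
`eventually_hfield`. [cite: BalabanImbrieJaffe1988, (5.7.7) p.290] -/
theorem norm_F1loc_le_printed_small (P : PolymerSys) [DecidableEq P.Poly] {α ζ p c rk : ℝ} (hα : 0 < α)
    (hζ : 0 < ζ) (hp : 0 ≤ p) (hc : 0 ≤ c * rk) :
    ∀ᶠ ej in 𝓝[>] (0 : ℝ), ∀ D : LocDatum β P.Poly, |D.aloc| ≤ p →
      (∀ m, 1 ≤ m → Ineq576 P (wloc D.wr D.A' m (D.assoc m)) c rk) →
      (∀ t : Fin 0 → β, P.card (D.assoc 0 t) ≤ 1) →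
      ∀ X : P.Poly, ‖D.F1loc ej ζ nbar X‖ ≤ ej ^ ((nbar : ℝ) + 1 - α) * Real.exp (-(c * rk) * P.cardMinus X) := by
  filter_upwards [eventually_mem_nhdsWithin, eventually_hfield nbar (p := p) hα hζ.le (by linarith)]
    with ej hej hfield D hpD h576 h0 X
  exact D.norm_F1loc_le_printed P hej hζ hpD hc h576 h0 hfield X

/-- **THE `V_j(X)` SIZE CLAUSE AS PRINTED, SMALL COUPLING**: for `e_j → 0⁺` (every `α′ > 0`; the weight `ρ > 0`, `ζ > 0`,
field/kernel bounds `p, M ≥ 0`, rates `κ ≥ κ′ ≥ 0` with the lattice-animal condition, the coefficient bound `C` and the field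
radius `R` fixed), for every vertex `V_j(y,y′) = Σ_k c_kF_kF′_k` whose factors are the expansions `glF1` of `F_{1,j}`-type
quantities (data rooted at `c₀`, `R`-connected associations, radius `≤ R`, `|a_loc| ≤ p`, (5.7.6) in the shape `|w_{b,m}(X)| ≤
M^m e^{−κ|X|}` for all `m ≥ 1`, the empty collection on one cube) with `Σ_k‖c_k‖ ≤ C`:
`‖V_j(X)‖ ≤ e_j^{n̄+1−α′}e^{−κ′|X|⁻}` — 2b's `norm_vertexAct_le_printed` with its constants inequality DISCHARGED.
[cite: BalabanImbrieJaffe1988, (5.7.7) p.290] -/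
theorem norm_vertexAct_le_printed_small {α' ρ C R ζ p M κ κ' : ℝ} {Radj : ι → ι → Prop}
    (hRs : ∀ x y, Radj x y → Radj y x) {nbr : ι → Finset ι} {Δ : ℕ} (hΔ : ∀ x, (nbr x).card ≤ Δ)
    (hnbr : ∀ x y, Radj x y → y ∈ nbr x) (hα : 0 < α') (hρ : 0 < ρ) (hζ : 0 < ζ) (hp : 0 ≤ p) (hM : 0 ≤ M)
    (hκ : 0 ≤ κ) (hκ' : 0 ≤ κ') (hsmall : ((Δ : ℝ) + 1) ^ 2 * Real.exp (-(κ - κ')) ≤ 1 / 2) (hC0 : 0 ≤ C)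
    (hR0 : 0 ≤ R) :
    ∀ᶠ ej in 𝓝[>] (0 : ℝ), ∀ (c : K → ℂ) (D D' : K → LocDatum β (Finset ι)), ∑ k, ‖c k‖ ≤ C →
      (∀ k m (t : Fin m → β), c₀ ∈ (D k).assoc m t ∧ c₀ ∈ (D' k).assoc m t) →
      (∀ k m (t : Fin m → β), IsRConnected Radj ((D k).assoc m t) ∧ IsRConnected Radj ((D' k).assoc m t)) →
      (∀ k, (D k).radius ≤ R ∧ (D' k).radius ≤ R) →
      (∀ k, |(D k).aloc| ≤ p ∧ |(D' k).aloc| ≤ p) →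
      (∀ k m, 1 ≤ m → ∀ X,
        |wloc (D k).wr (D k).A' m ((D k).assoc m) X| ≤ M ^ m * Real.exp (-κ * (cubePolymers ι).card X) ∧
        |wloc (D' k).wr (D' k).A' m ((D' k).assoc m) X| ≤ M ^ m * Real.exp (-κ * (cubePolymers ι).card X)) →
      (∀ k (t : Fin 0 → β),
        (cubePolymers ι).card ((D k).assoc 0 t) ≤ 1 ∧ (cubePolymers ι).card ((D' k).assoc 0 t) ≤ 1) →
      ∀ X : Finset ι,
        ‖vertexAct nbar ej c₀ c (fun k => glF1 (D k) ej ζ nbar) (fun k => glF1 (D' k) ej ζ nbar) X‖ ≤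
          ej ^ ((nbar : ℝ) + 1 - α') * Real.exp (-κ' * (cubePolymers ι).cardMinus X) := by
  have hL0 : 0 ≤ ρ * R * Real.exp (ρ * ζ * R) := by positivity
  have hev := eventually_regime_vertex (nbar := nbar) (L := ρ * R * Real.exp (ρ * ζ * R))
    (δ := fun ε => 2 * (ζ ^ nbar * (ε * (p + M)) ^ (nbar + 1) / ((nbar + 1).factorial : ℝ) *
      Real.exp (ε * ζ * (p + M)))) hα hρ hC0 hL0 (D1_nonneg hζ.le (add_nonneg hp hM))
    (fun ε hε => delta_nonneg hζ.le (add_nonneg hp hM) hε.le)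
    (fun ε hε hε1 => delta_le hζ.le (add_nonneg hp hM) hε.le hε1)
  filter_upwards [hev] with ej h c D D' hC hroot hconn hR hpD h576 h0 X
  obtain ⟨hej, hejρ, hconst⟩ := h
  have hδ0 := delta_nonneg (nbar := nbar) hζ.le (add_nonneg hp hM) hej.le
  refine norm_vertexAct_le_printed nbar c₀ hej hejρ hκ'
    (fun k => glF1_rooted (D k) ej ζ nbar fun m t => (hroot k m t).1)
    (fun k => glF1_rooted (D' k) ej ζ nbar fun m t => (hroot k m t).2)
    (fun k => lowNormW_glF1_le (D k) ej ζ nbar hζ hρ.le (hR k).1)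
    (fun k => lowNormW_glF1_le (D' k) ej ζ nbar hζ hρ.le (hR k).2)
    (fun k => actNorm_glF1_le (D k) ej ζ nbar hRs hΔ hnbr (fun m t => (hroot k m t).1)
      (fun m t => (hconn k m t).1) hej.le hζ (hpD k).1 hM hκ (fun m hm X => (h576 k m hm X).1)
      (fun t => (h0 k t).1) hsmall)
    (fun k => actNorm_glF1_le (D' k) ej ζ nbar hRs hΔ hnbr (fun m t => (hroot k m t).2)
      (fun m t => (hconn k m t).2) hej.le hζ (hpD k).2 hM hκ (fun m hm X => (h576 k m hm X).2)
      (fun t => (h0 k t).2) hsmall)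
    (le_trans (mul_le_mul_of_nonneg_right hC ?_) hconst) X
  positivity

/-- **THE `W^{(j)}(X)` KERNEL BOUND AS PRINTED, SMALL COUPLING**: for a weight `ρ > 0` with `gℓ(ρ) < 1`
(`exists_gl_lt_one`) and `e_j → 0⁺` (every `α′ > 0`; all other data fixed as above, plus the propagator sizes `γ`, `g` and the
number of sites of `□(x₁,x₂)`), for every propagator matrix `‖G(x,y)‖ ≤ γ`, `Σ_y‖G(x,y)‖ ≤ g` and every vertex of
`F_{1,j}`-type factors as above: `‖W^{(j)}(X; x₁, x₂)‖ ≤ e_j^{n̄+1−α′}e^{−κ′|X|⁻}` — 3's `norm_wExp_act_le_printed` through 6's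
`hyps_of_F1`, with `|e_j| ≤ ρ`, the convergence condition `θ < 1` and the constants inequality ALL DISCHARGED by
`eventually_regime`. [cite: BalabanImbrieJaffe1988, (5.7.7) p.290] -/
theorem norm_wAct_le_printed_small [Nonempty T] {α' ρ γ g C R ζ p M κ κ' : ℝ} {Radj : ι → ι → Prop}
    (hRs : ∀ x y, Radj x y → Radj y x) {nbr : ι → Finset ι} {Δ : ℕ} (hΔ : ∀ x, (nbr x).card ≤ Δ)
    (hnbr : ∀ x y, Radj x y → y ∈ nbr x) (hα : 0 < α') (hρ : 0 < ρ) (hζ : 0 < ζ) (hp : 0 ≤ p) (hM : 0 ≤ M)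
    (hκ : 0 ≤ κ) (hκ' : 0 ≤ κ') (hsmall : ((Δ : ℝ) + 1) ^ 2 * Real.exp (-(κ - κ')) ≤ 1 / 2) (hγ0 : 0 ≤ γ)
    (hg0 : 0 ≤ g) (hC0 : 0 ≤ C) (hR0 : 0 ≤ R)
    (hgℓ : g * (Fintype.card T * (C * (ρ * R * Real.exp (ρ * ζ * R) * (ρ * R * Real.exp (ρ * ζ * R))))) < 1) :
    ∀ᶠ ej in 𝓝[>] (0 : ℝ), ∀ (G : T → T → ℂ) (c : T → T → K → ℂ) (D D' : T → T → K → LocDatum β (Finset ι)),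
      (∀ x y, ‖G x y‖ ≤ γ) → (∀ x, ∑ y, ‖G x y‖ ≤ g) → (∀ y y', ∑ k, ‖c y y' k‖ ≤ C) →
      (∀ y y' k m (t : Fin m → β), c₀ ∈ (D y y' k).assoc m t ∧ c₀ ∈ (D' y y' k).assoc m t) →
      (∀ y y' k m (t : Fin m → β),
        IsRConnected Radj ((D y y' k).assoc m t) ∧ IsRConnected Radj ((D' y y' k).assoc m t)) →
      (∀ y y' k, (D y y' k).radius ≤ R ∧ (D' y y' k).radius ≤ R) →
      (∀ y y' k, |(D y y' k).aloc| ≤ p ∧ |(D' y y' k).aloc| ≤ p) →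
      (∀ y y' k m, 1 ≤ m → ∀ X,
        |wloc (D y y' k).wr (D y y' k).A' m ((D y y' k).assoc m) X| ≤ M ^ m * Real.exp (-κ * (cubePolymers ι).card X) ∧
        |wloc (D' y y' k).wr (D' y y' k).A' m ((D' y y' k).assoc m) X| ≤
          M ^ m * Real.exp (-κ * (cubePolymers ι).card X)) →
      (∀ y y' k (t : Fin 0 → β),
        (cubePolymers ι).card ((D y y' k).assoc 0 t) ≤ 1 ∧ (cubePolymers ι).card ((D' y y' k).assoc 0 t) ≤ 1) →
      ∀ (x₁ x₂ : T) (X : Finset ι),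
        ‖(wExp nbar ej c₀ G (fun y y' => vertexExp nbar ej c₀ (c y y') (fun k => glF1 (D y y' k) ej ζ nbar)
            (fun k => glF1 (D' y y' k) ej ζ nbar)) x₁ x₂).act X‖ ≤
          ej ^ ((nbar : ℝ) + 1 - α') * Real.exp (-κ' * (cubePolymers ι).cardMinus X) := by
  have hL0 : 0 ≤ ρ * R * Real.exp (ρ * ζ * R) := by positivity
  have hev := eventually_regime (nbar := nbar) (N := (Fintype.card T : ℝ)) (L := ρ * R * Real.exp (ρ * ζ * R))
    (δ := fun ε => 2 * (ζ ^ nbar * (ε * (p + M)) ^ (nbar + 1) / ((nbar + 1).factorial : ℝ) *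
      Real.exp (ε * ζ * (p + M)))) hα hρ hγ0 hg0 (Nat.cast_nonneg _) hC0 hL0 (D1_nonneg hζ.le (add_nonneg hp hM))
    (fun ε hε => delta_nonneg hζ.le (add_nonneg hp hM) hε.le)
    (fun ε hε hε1 => delta_le hζ.le (add_nonneg hp hM) hε.le hε1) hgℓ
  filter_upwards [hev] with ej h G c D D' hγ hg hC hroot hconn hR hpD h576 h0 x₁ x₂ X
  obtain ⟨hej, hejρ, hθ, hconst⟩ := h
  exact (hyps_of_F1 nbar c₀ G c D D' ej ζ hRs hΔ hnbr hρ hejρ hej.le hζ hp hM hκ hκ' hsmall hroot hconn hR hpD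
    h576 h0 hC hγ hg hR0 le_rfl le_rfl hθ).norm_wExp_act_le_printed hconst x₁ x₂ X

/-- **THRESHOLD FORM**: there is `e₀ > 0` (depending only on `n̄, α′, ρ, γ, g, C, R, ζ, p, M` and the number of sites of
`□(x₁,x₂)`) such that the printed kernel bound holds for every `0 < e_j < e₀`. [cite: BalabanImbrieJaffe1988, (5.7.7) p.290] -/
theorem norm_wAct_le_printed_threshold [Nonempty T] {α' ρ γ g C R ζ p M κ κ' : ℝ} {Radj : ι → ι → Prop}
    (hRs : ∀ x y, Radj x y → Radj y x) {nbr : ι → Finset ι} {Δ : ℕ} (hΔ : ∀ x, (nbr x).card ≤ Δ)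
    (hnbr : ∀ x y, Radj x y → y ∈ nbr x) (hα : 0 < α') (hρ : 0 < ρ) (hζ : 0 < ζ) (hp : 0 ≤ p) (hM : 0 ≤ M)
    (hκ : 0 ≤ κ) (hκ' : 0 ≤ κ') (hsmall : ((Δ : ℝ) + 1) ^ 2 * Real.exp (-(κ - κ')) ≤ 1 / 2) (hγ0 : 0 ≤ γ)
    (hg0 : 0 ≤ g) (hC0 : 0 ≤ C) (hR0 : 0 ≤ R)
    (hgℓ : g * (Fintype.card T * (C * (ρ * R * Real.exp (ρ * ζ * R) * (ρ * R * Real.exp (ρ * ζ * R))))) < 1) :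
    ∃ e₀, 0 < e₀ ∧ ∀ ej, 0 < ej → ej < e₀ →
      ∀ (G : T → T → ℂ) (c : T → T → K → ℂ) (D D' : T → T → K → LocDatum β (Finset ι)),
      (∀ x y, ‖G x y‖ ≤ γ) → (∀ x, ∑ y, ‖G x y‖ ≤ g) → (∀ y y', ∑ k, ‖c y y' k‖ ≤ C) →
      (∀ y y' k m (t : Fin m → β), c₀ ∈ (D y y' k).assoc m t ∧ c₀ ∈ (D' y y' k).assoc m t) →
      (∀ y y' k m (t : Fin m → β),
        IsRConnected Radj ((D y y' k).assoc m t) ∧ IsRConnected Radj ((D' y y' k).assoc m t)) →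
      (∀ y y' k, (D y y' k).radius ≤ R ∧ (D' y y' k).radius ≤ R) →
      (∀ y y' k, |(D y y' k).aloc| ≤ p ∧ |(D' y y' k).aloc| ≤ p) →
      (∀ y y' k m, 1 ≤ m → ∀ X,
        |wloc (D y y' k).wr (D y y' k).A' m ((D y y' k).assoc m) X| ≤ M ^ m * Real.exp (-κ * (cubePolymers ι).card X) ∧
        |wloc (D' y y' k).wr (D' y y' k).A' m ((D' y y' k).assoc m) X| ≤
          M ^ m * Real.exp (-κ * (cubePolymers ι).card X)) →
      (∀ y y' k (t : Fin 0 → β),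
        (cubePolymers ι).card ((D y y' k).assoc 0 t) ≤ 1 ∧ (cubePolymers ι).card ((D' y y' k).assoc 0 t) ≤ 1) →
      ∀ (x₁ x₂ : T) (X : Finset ι),
        ‖(wExp nbar ej c₀ G (fun y y' => vertexExp nbar ej c₀ (c y y') (fun k => glF1 (D y y' k) ej ζ nbar)
            (fun k => glF1 (D' y y' k) ej ζ nbar)) x₁ x₂).act X‖ ≤
          ej ^ ((nbar : ℝ) + 1 - α') * Real.exp (-κ' * (cubePolymers ι).cardMinus X) :=
  exists_threshold (norm_wAct_le_printed_small nbar c₀ hRs hΔ hnbr hα hρ hζ hp hM hκ hκ' hsmall hγ0 hg0 hC0 hR0 hgℓ)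

end Printed

end Literature.MathematicalPhysics.QuantumFieldTheory.BalabanImbrieJaffe1984to88.BIJ88WSplit290Small

end
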